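import Literature.NumberTheory.LFunctions.WeilMellinBounds
import Literature.NumberTheory.LFunctions.WeilArchimedeanMoments
import Mathlib.Analysis.Calculus.BumpFunction.InnerProduct
import Mathlib.Analysis.Calculus.MeanValue
import HarnessLib

/-!
# `IntegerScrew.ScrewPolyFloor`, line `weil-comb-floor` — stub S4 `stub_bumpWitness`

Crux `ScrewPolyFloor` (stmt-RiemannHypothesis-15757) of route IntegerScrew, line `weil-comb-floor`
(skeleton `Cruxes/ScrewPolyFloor/Lines/weil_comb_floor.lean`).  The line needs ONE admissible
tooth for the log-integer comb: a Weil test function `φ` (smooth, compactly supported) with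
`tsupport φ ⊆ [-1, 1]`, `‖φ‖₂² = ∫ ‖φ‖² > 0` (the archimedean diagonal of the Weil form is
`∝ ‖φ‖₂²`) and `‖φ'‖₁' = ∫ ‖φ'‖ e^{|t|/2} > 0` (the constant in the one-step decay of `φ̂`).
This file provides it: Mathlib's smooth bump centred at `0` with radii `1/2 < 1`, cast to `ℂ`.
`‖φ‖₂² > 0` because `φ(0) = 1`; `‖φ'‖₁' > 0` because a differentiable function on `ℝ` with
identically vanishing derivative is constant (`is_const_of_deriv_eq_zero`) while `φ(0) = 1 ≠ 0 = φ(1)`.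
-/

noncomputable section

-- the layout-mandated namespace `Summit.RiemannHypothesis.RiemannHypothesis.…` repeats the summit name
set_option linter.dupNamespace false

namespace Summit.RiemannHypothesis.RiemannHypothesis.Theorems.IntegerScrewScrewPolyFloor

open Literature.NumberTheory.LFunctions MeasureTheory

/-- **Stub S4 `stub_bumpWitness` of line `weil-comb-floor`**: there is a Weil test function `φ`
with `tsupport φ ⊆ [-1, 1]`, `0 < ∫ ‖φ‖²` and `0 < ∫ ‖φ'‖ e^{|t|/2}` (Mathlib's `ContDiffBump`
with radii `1/2 < 1`, cast to `ℂ`). -/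
theorem stub_bumpWitness : ∃ φ : ℝ → ℂ, Literature.NumberTheory.LFunctions.IsWeilTest φ ∧
    tsupport φ ⊆ Set.Icc (-1) 1 ∧ 0 < Literature.NumberTheory.LFunctions.weilNorm2Sq φ ∧
    0 < Literature.NumberTheory.LFunctions.weilL1 (deriv φ) := by
  let β : ContDiffBump (0 : ℝ) := ⟨1 / 2, 1, by norm_num, by norm_num⟩
  set φ : ℝ → ℂ := fun t => ((β t : ℝ) : ℂ) with hφ
  have hW : IsWeilTest φ :=
    ⟨Complex.ofRealCLM.contDiff.comp β.contDiff, β.hasCompactSupport.comp_left Complex.ofReal_zero⟩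
  have hβ0 : β 0 = 1 := β.one_of_mem_closedBall (Metric.mem_closedBall_self (by norm_num))
  have hβ1 : β 1 = 0 := β.zero_of_le_dist (by simp [β])
  refine ⟨φ, hW, ?_, ?_, ?_⟩
  · -- support in `[-1, 1]`
    have hs : Function.support φ = Function.support β := by
      ext t
      simp [hφ, Function.mem_support]
    have ht : tsupport φ = tsupport β := by simp only [tsupport, hs]
    rw [ht, β.tsupport_eq, Real.closedBall_eq_Icc, zero_sub, zero_add]
  · -- `‖φ‖₂² > 0`
    unfold weilNorm2Sq
    have e : (fun x : ℝ => ‖φ x‖ ^ 2) = fun x => β x ^ 2 := by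
      funext x
      simp [hφ, Complex.norm_real, Real.norm_eq_abs, abs_of_nonneg β.nonneg]
    rw [e]
    have hcont : Continuous fun x ↦ β x ^ 2 := β.continuous.pow 2
    have hcs : HasCompactSupport fun x ↦ β x ^ 2 := by
      have : (fun x ↦ β x ^ 2) = fun x ↦ β x * β x := by funext x; ring
      rw [this]; exact β.hasCompactSupport.mul_right
    refine hcont.integral_pos_of_hasCompactSupport_nonneg_nonzero hcs (fun x ↦ sq_nonneg _)
      (x := 0) ?_
    rw [hβ0]; norm_num
  · -- `‖φ'‖₁' > 0`
    unfold weilL1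
    have hd : IsWeilTest (deriv φ) := hW.deriv
    have hcont : Continuous fun t : ℝ => ‖deriv φ t‖ * Real.exp (|t| / 2) :=
      hd.1.continuous.norm.mul (by fun_prop)
    have hcs : HasCompactSupport fun t : ℝ => ‖deriv φ t‖ * Real.exp (|t| / 2) :=
      hd.2.norm.mul_right
    obtain ⟨c, hc⟩ : ∃ c, deriv φ c ≠ 0 := by
      by_contra h
      push Not at h
      have hconst := is_const_of_deriv_eq_zero (hW.1.differentiable (by simp)) h 0 1
      simp [hφ, hβ0, hβ1] at hconst
    exact hcont.integral_pos_of_hasCompactSupport_nonneg_nonzero hcs (fun t ↦ by positivity)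
      (x := c) (mul_ne_zero (norm_ne_zero_iff.2 hc) (Real.exp_pos _).ne')

end Summit.RiemannHypothesis.RiemannHypothesis.Theorems.IntegerScrewScrewPolyFloor

end
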